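import Mathlib
import Summits.Ventures.HodgeRepro.Tier4.Target
import Summits.Ventures.HodgeRepro.Tier4.Common.TargetBall

/-!
# Tier4/Common/BallBounds — entry bounds for `U(2,1)` and for matrices preserving a definite hermitian form

Blind re-derivation cell `pub-hodge-repro`, Tier 4 «prove the step» (README §9–§10), seat t4-L4-p1 (prover, LINE L4,
gen 0; lead's assignment S12161 (3), shared module announced S12255).  Tree path
`lean/Summits/Ventures/HodgeRepro/Tier4/Common/BallBounds.lean`.  Mathlib-level facts about `3 × 3` complex matrices, on
the frozen target's own objects (`J`, `nsq`, `lift3`, `actM`, `ball`, `IsDefinite` of `Tier4/Target.lean`; typer-2's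
`quadJ`, `lift3_actM`, `mulVec_lift3_two_ne_zero` of `Tier4/Common/TargetBall.lean`).  No literature input.

WHAT IS PROVED.
* `exists_bound_of_isDefinite`: a matrix `g` with `gᴴ P g = P` for a DEFINITE hermitian `P` has all entries bounded by a
  constant depending only on `P` (the form is bounded below on the unit sphere by compactness and above by the entry
  sum; `g` preserves it).
* `norm_entry_le_of_U21`: every entry of `M ∈ U(2,1)` (`Mᴴ J M = J`) is bounded by `‖M 2 2‖` (the column and row
  relations `‖M 0 j‖² + ‖M 1 j‖² − ‖M 2 j‖² = J j j`, `‖M i 0‖² + ‖M i 1‖² − ‖M i 2‖² = J i i`).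
* `norm_entry_le_of_mem_ball`: **the proper-discontinuity bound** — if `M ∈ U(2,1)` moves a point `z` of the ball with
  `nsq z ≤ t²` to a point with `nsq (M·z) ≤ t²` (`0 ≤ t < 1`), then every entry of `M` is bounded by
  `1 / ((1 − t) √(1 − t²))`: from `‖M 2 2‖ (1 − √(nsq z)) ≤ ‖(M (z,1))₂‖` (Cauchy–Schwarz on the third row) and
  `‖(M (z,1))₂‖² (1 − nsq (M·z)) = 1 − nsq z` (invariance of `quadJ`).
* `cnorm`: the entry sum, with the crude product bound `norm_mul_apply_le`.

Consumed by `Tier4/Common/FundamentalDomain.lean` (discreteness of the arithmetic group and the Borel transversal).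
HC_CM is NOT proved by anyone in this repository.
-/

set_option autoImplicit false

noncomputable section

open Matrix Metric NumberField MeasureTheory
open scoped ComplexConjugate ComplexOrder Pointwise

namespace Summit.Ventures.HodgeRepro.Tier4

/-! ## B. The definite places: a matrix preserving a definite hermitian form has bounded entries -/

section Definite

/-- The hermitian form `q_P(x) = x̄ᵀ P x` is preserved by `g` with `gᴴ P g = P`. -/
theorem star_dotProduct_mulVec_mulVec {P g : Matrix (Fin 3) (Fin 3) ℂ} (hg : gᴴ * P * g = P) (x : Fin 3 → ℂ) :
    star (g *ᵥ x) ⬝ᵥ (P *ᵥ (g *ᵥ x)) = star x ⬝ᵥ (P *ᵥ x) := by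
  rw [Matrix.star_mulVec, Matrix.mulVec_mulVec, Matrix.dotProduct_mulVec, Matrix.vecMul_vecMul,
    ← Matrix.mul_assoc, hg, ← Matrix.dotProduct_mulVec]

/-- Homogeneity: `q_P(c x) = ‖c‖² q_P(x)`. -/
theorem star_dotProduct_mulVec_smul (P : Matrix (Fin 3) (Fin 3) ℂ) (c : ℂ) (x : Fin 3 → ℂ) :
    star (c • x) ⬝ᵥ (P *ᵥ (c • x)) = ((‖c‖ ^ 2 : ℝ) : ℂ) * (star x ⬝ᵥ (P *ᵥ x)) := by
  rw [Matrix.mulVec_smul, star_smul, smul_dotProduct, dotProduct_smul, smul_eq_mul, smul_eq_mul, ← mul_assoc,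
    Complex.star_def, Complex.conj_mul']
  push_cast
  ring

/-- The crude upper bound `‖q_P(x)‖ ≤ (Σ_{i,j} ‖P i j‖) ‖x‖²`. -/
theorem norm_star_dotProduct_mulVec_le (P : Matrix (Fin 3) (Fin 3) ℂ) (x : Fin 3 → ℂ) :
    ‖star x ⬝ᵥ (P *ᵥ x)‖ ≤ (∑ i, ∑ j, ‖P i j‖) * ‖x‖ ^ 2 := by
  simp only [dotProduct, Matrix.mulVec, Pi.star_apply, Finset.mul_sum]
  rw [Finset.sum_mul]
  refine (norm_sum_le _ _).trans (Finset.sum_le_sum fun i _ => ?_)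
  rw [Finset.sum_mul]
  refine (norm_sum_le _ _).trans (Finset.sum_le_sum fun j _ => ?_)
  rw [norm_mul, norm_star, norm_mul]
  have hxi : ‖x i‖ ≤ ‖x‖ := norm_le_pi_norm x i
  have hxj : ‖x j‖ ≤ ‖x‖ := norm_le_pi_norm x j
  calc ‖x i‖ * (‖P i j‖ * ‖x j‖) ≤ ‖x‖ * (‖P i j‖ * ‖x‖) := by gcongr
    _ = ‖P i j‖ * ‖x‖ ^ 2 := by ring

/-- **Lower bound of a positive definite form**: `m ‖x‖² ≤ re q_P(x)` for some `m > 0`. -/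
theorem exists_pos_le_re_star_dotProduct_mulVec {P : Matrix (Fin 3) (Fin 3) ℂ} (hP : P.PosDef) :
    ∃ m : ℝ, 0 < m ∧ ∀ x : Fin 3 → ℂ, m * ‖x‖ ^ 2 ≤ (star x ⬝ᵥ (P *ᵥ x)).re := by
  set q : (Fin 3 → ℂ) → ℝ := fun x => (star x ⬝ᵥ (P *ᵥ x)).re with hq
  have hcont : Continuous q := by
    refine Complex.continuous_re.comp ?_
    simp only [dotProduct, Matrix.mulVec]
    fun_prop
  have hsph : (sphere (0 : Fin 3 → ℂ) 1).Nonempty := NormedSpace.sphere_nonempty.2 zero_le_one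
  obtain ⟨x₀, hx₀, hmin⟩ := (isCompact_sphere (0 : Fin 3 → ℂ) 1).exists_isMinOn hsph hcont.continuousOn
  have hx₀ne : x₀ ≠ 0 := by
    intro h
    rw [h] at hx₀
    simp at hx₀
  have hm : 0 < q x₀ := by
    have := hP.dotProduct_mulVec_pos hx₀ne
    exact (Complex.lt_def.1 this).1
  refine ⟨q x₀, hm, fun x => ?_⟩
  by_cases hx : x = 0
  · subst hx; simp [hq]
  · have hnx : 0 < ‖x‖ := norm_pos_iff.2 hx
    set c : ℂ := ((‖x‖⁻¹ : ℝ) : ℂ) with hc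
    have hcx : c • x ∈ sphere (0 : Fin 3 → ℂ) 1 := by
      rw [mem_sphere_zero_iff_norm, norm_smul, hc, Complex.norm_real, Real.norm_of_nonneg (by positivity),
        inv_mul_cancel₀ hnx.ne']
    have h1 : q x₀ ≤ q (c • x) := hmin hcx
    have h2 : q (c • x) = ‖x‖⁻¹ ^ 2 * q x := by
      simp only [hq]
      rw [star_dotProduct_mulVec_smul, Complex.re_ofReal_mul, hc, Complex.norm_real,
        Real.norm_of_nonneg (by positivity)]
    rw [h2] at h1
    have h3 : ‖x‖ ^ 2 * (‖x‖⁻¹ ^ 2 * q x) = q x := by field_simp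
    calc q x₀ * ‖x‖ ^ 2 ≤ (‖x‖⁻¹ ^ 2 * q x) * ‖x‖ ^ 2 := by gcongr
      _ = q x := by rw [mul_comm, h3]

/-- **A matrix preserving a positive definite form has bounded entries**, with a bound depending only on the form. -/
theorem exists_bound_of_posDef {P : Matrix (Fin 3) (Fin 3) ℂ} (hP : P.PosDef) :
    ∃ B : ℝ, ∀ g : Matrix (Fin 3) (Fin 3) ℂ, gᴴ * P * g = P → ∀ i j, ‖g i j‖ ≤ B := by
  obtain ⟨m, hm, hlow⟩ := exists_pos_le_re_star_dotProduct_mulVec hP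
  set S : ℝ := ∑ i, ∑ j, ‖P i j‖ with hS
  refine ⟨Real.sqrt (S / m), fun g hg i j => ?_⟩
  have hx : ‖(Pi.single j (1 : ℂ) : Fin 3 → ℂ)‖ = 1 := by
    simpa using Pi.norm_single (G := fun _ : Fin 3 => ℂ) (i := j) (1 : ℂ)
  have hgx : g *ᵥ Pi.single j (1 : ℂ) = g.col j := Matrix.mulVec_single_one g j
  -- `m ‖g e_j‖² ≤ re q(g e_j) = re q(e_j) ≤ S`
  have h1 : m * ‖g *ᵥ Pi.single j (1 : ℂ)‖ ^ 2 ≤ S := by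
    calc m * ‖g *ᵥ Pi.single j (1 : ℂ)‖ ^ 2 ≤ (star (g *ᵥ Pi.single j 1) ⬝ᵥ (P *ᵥ (g *ᵥ Pi.single j 1))).re :=
          hlow _
      _ = (star (Pi.single j (1 : ℂ)) ⬝ᵥ (P *ᵥ Pi.single j 1)).re := by rw [star_dotProduct_mulVec_mulVec hg]
      _ ≤ ‖star (Pi.single j (1 : ℂ)) ⬝ᵥ (P *ᵥ Pi.single j 1)‖ := Complex.re_le_norm _
      _ ≤ S * ‖(Pi.single j (1 : ℂ) : Fin 3 → ℂ)‖ ^ 2 := norm_star_dotProduct_mulVec_le P _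
      _ = S := by rw [hx]; ring
  have h2 : ‖g i j‖ ≤ ‖g *ᵥ Pi.single j (1 : ℂ)‖ := by
    rw [hgx]
    exact norm_le_pi_norm (g.col j) i
  have h3 : ‖g *ᵥ Pi.single j (1 : ℂ)‖ ^ 2 ≤ S / m := by
    rw [le_div_iff₀ hm]
    linarith [h1]
  calc ‖g i j‖ ≤ ‖g *ᵥ Pi.single j (1 : ℂ)‖ := h2
    _ ≤ Real.sqrt (S / m) := Real.le_sqrt_of_sq_le h3

/-- The same for a definite (positive or negative) form. -/
theorem exists_bound_of_isDefinite {P : Matrix (Fin 3) (Fin 3) ℂ} (hP : IsDefinite P) :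
    ∃ B : ℝ, ∀ g : Matrix (Fin 3) (Fin 3) ℂ, gᴴ * P * g = P → ∀ i j, ‖g i j‖ ≤ B := by
  rcases hP with hP | hP
  · exact exists_bound_of_posDef hP
  · obtain ⟨B, hB⟩ := exists_bound_of_posDef hP
    refine ⟨B, fun g hg i j => hB g ?_ i j⟩
    rw [Matrix.mul_neg, Matrix.neg_mul, hg]

end Definite

/-! ## B′. Crude entry norms -/

section CNorm

/-- The sum of the norms of all entries of a `3 × 3` complex matrix. -/
def cnorm (A : Matrix (Fin 3) (Fin 3) ℂ) : ℝ := ∑ a, ∑ b, ‖A a b‖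

/-- `0 ≤ cnorm A`. -/
theorem cnorm_nonneg (A : Matrix (Fin 3) (Fin 3) ℂ) : 0 ≤ cnorm A := by
  unfold cnorm
  positivity

/-- Every entry is bounded by the entry sum. -/
theorem norm_apply_le_cnorm (A : Matrix (Fin 3) (Fin 3) ℂ) (i j : Fin 3) : ‖A i j‖ ≤ cnorm A := by
  unfold cnorm
  calc ‖A i j‖ ≤ ∑ b, ‖A i b‖ :=
        Finset.single_le_sum (f := fun b => ‖A i b‖) (fun b _ => norm_nonneg _) (Finset.mem_univ j)
    _ ≤ ∑ a, ∑ b, ‖A a b‖ :=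
        Finset.single_le_sum (f := fun a => ∑ b, ‖A a b‖) (fun a _ => by positivity) (Finset.mem_univ i)

/-- If every entry is bounded by `K`, the entry sum is bounded by `9 K`. -/
theorem cnorm_le_of_forall {A : Matrix (Fin 3) (Fin 3) ℂ} {K : ℝ} (hK : ∀ i j, ‖A i j‖ ≤ K) : cnorm A ≤ 9 * K := by
  unfold cnorm
  calc ∑ a, ∑ b, ‖A a b‖ ≤ ∑ a : Fin 3, ∑ b : Fin 3, K :=
        Finset.sum_le_sum fun a _ => Finset.sum_le_sum fun b _ => hK a b
    _ = 9 * K := by simp [Finset.sum_const, Finset.card_univ, Fintype.card_fin]; ring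

/-- The crude product bound `‖(A B) i j‖ ≤ 3 · cnorm A · cnorm B`. -/
theorem norm_mul_apply_le (A B : Matrix (Fin 3) (Fin 3) ℂ) (i j : Fin 3) :
    ‖(A * B) i j‖ ≤ 3 * (cnorm A * cnorm B) := by
  rw [Matrix.mul_apply]
  calc ‖∑ k, A i k * B k j‖ ≤ ∑ k, ‖A i k * B k j‖ := norm_sum_le _ _
    _ ≤ ∑ k : Fin 3, cnorm A * cnorm B := by
        refine Finset.sum_le_sum fun k _ => ?_
        rw [norm_mul]
        exact mul_le_mul (norm_apply_le_cnorm A i k) (norm_apply_le_cnorm B k j) (norm_nonneg _) (cnorm_nonneg A)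
    _ = 3 * (cnorm A * cnorm B) := by simp [Finset.sum_const, Finset.card_univ, Fintype.card_fin]

end CNorm

/-! ## C. Entry bounds for `U(2,1)` -/

section U21

variable {M : Matrix (Fin 3) (Fin 3) ℂ}

/-- `J² = 1`. -/
theorem J_mul_J : J * J = 1 := by
  ext i j
  fin_cases i <;> fin_cases j <;> simp [J, Matrix.mul_apply, Fin.sum_univ_three]

/-- `M J Mᴴ = J` for `M ∈ U(2,1)`. -/
theorem mul_J_conjTranspose_of_U21 (hM : Mᴴ * J * M = J) : M * J * Mᴴ = J := by
  have h1 : (J * Mᴴ * J) * M = 1 := by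
    calc (J * Mᴴ * J) * M = J * (Mᴴ * J * M) := by simp only [Matrix.mul_assoc]
      _ = 1 := by rw [hM, J_mul_J]
  have h2 : M * (J * Mᴴ * J) = 1 := mul_eq_one_comm.1 h1
  have h3 : M * J * Mᴴ = M * (J * Mᴴ * J) * J := by
    simp only [Matrix.mul_assoc, J_mul_J, Matrix.mul_one]
  rw [h3, h2, Matrix.one_mul]

/-- The `(j, j)` entry of `Mᴴ J M`: `‖M 0 j‖² + ‖M 1 j‖² − ‖M 2 j‖²`. -/
theorem conjTranspose_mul_J_mul_apply (M : Matrix (Fin 3) (Fin 3) ℂ) (j : Fin 3) :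
    (Mᴴ * J * M) j j = (‖M 0 j‖ ^ 2 + ‖M 1 j‖ ^ 2 - ‖M 2 j‖ ^ 2 : ℝ) := by
  have h0 := Complex.conj_mul' (M 0 j)
  have h1 := Complex.conj_mul' (M 1 j)
  have h2 := Complex.conj_mul' (M 2 j)
  rw [Matrix.mul_apply]
  simp only [J, Matrix.mul_diagonal, Matrix.conjTranspose_apply, Fin.sum_univ_three, Complex.star_def]
  simp
  linear_combination h0 + h1 - h2

/-- The `(i, i)` entry of `M J Mᴴ`: `‖M i 0‖² + ‖M i 1‖² − ‖M i 2‖²`. -/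
theorem mul_J_mul_conjTranspose_apply (M : Matrix (Fin 3) (Fin 3) ℂ) (i : Fin 3) :
    (M * J * Mᴴ) i i = (‖M i 0‖ ^ 2 + ‖M i 1‖ ^ 2 - ‖M i 2‖ ^ 2 : ℝ) := by
  have h0 := Complex.mul_conj' (M i 0)
  have h1 := Complex.mul_conj' (M i 1)
  have h2 := Complex.mul_conj' (M i 2)
  rw [Matrix.mul_apply]
  simp only [J, Matrix.mul_diagonal, Matrix.conjTranspose_apply, Fin.sum_univ_three, Complex.star_def]
  simp
  linear_combination h0 + h1 - h2

/-- Column relations of `M ∈ U(2,1)`: `‖M 0 j‖² + ‖M 1 j‖² − ‖M 2 j‖² = J j j`. -/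
theorem col_rel_of_U21 (hM : Mᴴ * J * M = J) (j : Fin 3) :
    ‖M 0 j‖ ^ 2 + ‖M 1 j‖ ^ 2 - ‖M 2 j‖ ^ 2 = (if j = 2 then -1 else 1 : ℝ) := by
  have := conjTranspose_mul_J_mul_apply M j
  rw [hM] at this
  have hJ : J j j = (if j = 2 then -1 else 1 : ℝ) := by
    fin_cases j <;> simp [J]
  rw [hJ] at this
  exact_mod_cast this.symm

/-- Row relations of `M ∈ U(2,1)`: `‖M i 0‖² + ‖M i 1‖² − ‖M i 2‖² = J i i`. -/
theorem row_rel_of_U21 (hM : Mᴴ * J * M = J) (i : Fin 3) :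
    ‖M i 0‖ ^ 2 + ‖M i 1‖ ^ 2 - ‖M i 2‖ ^ 2 = (if i = 2 then -1 else 1 : ℝ) := by
  have := mul_J_mul_conjTranspose_apply M i
  rw [mul_J_conjTranspose_of_U21 hM] at this
  have hJ : J i i = (if i = 2 then -1 else 1 : ℝ) := by
    fin_cases i <;> simp [J]
  rw [hJ] at this
  exact_mod_cast this.symm

/-- `‖M 2 2‖ ≥ 1` for `M ∈ U(2,1)`. -/
theorem one_le_norm_two_two_of_U21 (hM : Mᴴ * J * M = J) : 1 ≤ ‖M 2 2‖ := by
  have h := col_rel_of_U21 hM 2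
  simp only [if_true] at h
  nlinarith [sq_nonneg ‖M 0 2‖, sq_nonneg ‖M 1 2‖, norm_nonneg (M 2 2)]

/-- The squares of the entries of `M ∈ U(2,1)` are bounded by `‖M 2 2‖²`. -/
theorem sq_norm_entry_le_of_U21 (hM : Mᴴ * J * M = J) (i j : Fin 3) : ‖M i j‖ ^ 2 ≤ ‖M 2 2‖ ^ 2 := by
  have hc0 := col_rel_of_U21 hM 0
  have hc1 := col_rel_of_U21 hM 1
  have hc2 := col_rel_of_U21 hM 2
  have hr2 := row_rel_of_U21 hM 2
  simp only [Fin.isValue, Fin.reduceEq, if_false, if_true] at hc0 hc1 hc2 hr2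
  have h00 : ‖M 0 0‖ ^ 2 ≤ ‖M 2 2‖ ^ 2 := by nlinarith [sq_nonneg ‖M 1 0‖, sq_nonneg ‖M 2 1‖]
  have h01 : ‖M 0 1‖ ^ 2 ≤ ‖M 2 2‖ ^ 2 := by nlinarith [sq_nonneg ‖M 1 1‖, sq_nonneg ‖M 2 0‖]
  have h02 : ‖M 0 2‖ ^ 2 ≤ ‖M 2 2‖ ^ 2 := by nlinarith [sq_nonneg ‖M 1 2‖]
  have h10 : ‖M 1 0‖ ^ 2 ≤ ‖M 2 2‖ ^ 2 := by nlinarith [sq_nonneg ‖M 0 0‖, sq_nonneg ‖M 2 1‖]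
  have h11 : ‖M 1 1‖ ^ 2 ≤ ‖M 2 2‖ ^ 2 := by nlinarith [sq_nonneg ‖M 0 1‖, sq_nonneg ‖M 2 0‖]
  have h12 : ‖M 1 2‖ ^ 2 ≤ ‖M 2 2‖ ^ 2 := by nlinarith [sq_nonneg ‖M 0 2‖]
  have h20 : ‖M 2 0‖ ^ 2 ≤ ‖M 2 2‖ ^ 2 := by nlinarith [sq_nonneg ‖M 2 1‖]
  have h21 : ‖M 2 1‖ ^ 2 ≤ ‖M 2 2‖ ^ 2 := by nlinarith [sq_nonneg ‖M 2 0‖]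
  have h22 : ‖M 2 2‖ ^ 2 ≤ ‖M 2 2‖ ^ 2 := le_rfl
  fin_cases i <;> fin_cases j <;> assumption

/-- **Every entry of `M ∈ U(2,1)` is bounded by `‖M 2 2‖`.** -/
theorem norm_entry_le_of_U21 (hM : Mᴴ * J * M = J) (i j : Fin 3) : ‖M i j‖ ≤ ‖M 2 2‖ :=
  (pow_le_pow_iff_left₀ (norm_nonneg _) (norm_nonneg _) two_ne_zero).1 (sq_norm_entry_le_of_U21 hM i j)

/-- `0 ≤ nsq z`. -/
theorem nsq_nonneg (z : Fin 2 → ℂ) : 0 ≤ nsq z := by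
  unfold nsq
  positivity

/-- The denominator of the action, written out. -/
theorem mulVec_lift3_two (M : Matrix (Fin 3) (Fin 3) ℂ) (z : Fin 2 → ℂ) :
    (M *ᵥ lift3 z) 2 = M 2 0 * z 0 + M 2 1 * z 1 + M 2 2 := by
  simp [Matrix.mulVec, dotProduct, Fin.sum_univ_three, lift3]

/-- Two-term Cauchy–Schwarz: `‖a z₀ + b z₁‖² ≤ (‖a‖² + ‖b‖²)(‖z₀‖² + ‖z₁‖²)`. -/
theorem sq_norm_add_mul_le (a b z₀ z₁ : ℂ) :
    ‖a * z₀ + b * z₁‖ ^ 2 ≤ (‖a‖ ^ 2 + ‖b‖ ^ 2) * (‖z₀‖ ^ 2 + ‖z₁‖ ^ 2) := by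
  have h1 : ‖a * z₀ + b * z₁‖ ≤ ‖a‖ * ‖z₀‖ + ‖b‖ * ‖z₁‖ := by
    calc ‖a * z₀ + b * z₁‖ ≤ ‖a * z₀‖ + ‖b * z₁‖ := norm_add_le _ _
      _ = ‖a‖ * ‖z₀‖ + ‖b‖ * ‖z₁‖ := by rw [norm_mul, norm_mul]
  have h2 : (‖a‖ * ‖z₀‖ + ‖b‖ * ‖z₁‖) ^ 2 ≤ (‖a‖ ^ 2 + ‖b‖ ^ 2) * (‖z₀‖ ^ 2 + ‖z₁‖ ^ 2) := by
    nlinarith [sq_nonneg (‖a‖ * ‖z₁‖ - ‖b‖ * ‖z₀‖)]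
  calc ‖a * z₀ + b * z₁‖ ^ 2 ≤ (‖a‖ * ‖z₀‖ + ‖b‖ * ‖z₁‖) ^ 2 :=
        pow_le_pow_left₀ (norm_nonneg _) h1 2
    _ ≤ _ := h2

/-- **The key inequality**: for `M ∈ U(2,1)` and any `z`, `‖M 2 2‖ · (1 − √(nsq z)) ≤ ‖(M (z,1))₂‖`. -/
theorem norm_two_two_mul_le (hM : Mᴴ * J * M = J) (z : Fin 2 → ℂ) :
    ‖M 2 2‖ * (1 - Real.sqrt (nsq z)) ≤ ‖(M *ᵥ lift3 z) 2‖ := by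
  have hr2 := row_rel_of_U21 hM 2
  simp only [if_true] at hr2
  have hcs := sq_norm_add_mul_le (M 2 0) (M 2 1) (z 0) (z 1)
  have hnsq : ‖z 0‖ ^ 2 + ‖z 1‖ ^ 2 = nsq z := rfl
  rw [hnsq] at hcs
  have hbound : ‖M 2 0 * z 0 + M 2 1 * z 1‖ ≤ ‖M 2 2‖ * Real.sqrt (nsq z) := by
    have hsq : ‖M 2 0 * z 0 + M 2 1 * z 1‖ ^ 2 ≤ (‖M 2 2‖ * Real.sqrt (nsq z)) ^ 2 := by
      rw [mul_pow, Real.sq_sqrt (nsq_nonneg z)]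
      have : ‖M 2 0‖ ^ 2 + ‖M 2 1‖ ^ 2 ≤ ‖M 2 2‖ ^ 2 := by linarith
      have hn : (0 : ℝ) ≤ nsq z := nsq_nonneg z
      calc ‖M 2 0 * z 0 + M 2 1 * z 1‖ ^ 2 ≤ (‖M 2 0‖ ^ 2 + ‖M 2 1‖ ^ 2) * nsq z := hcs
        _ ≤ ‖M 2 2‖ ^ 2 * nsq z := by gcongr
    exact (pow_le_pow_iff_left₀ (norm_nonneg _) (mul_nonneg (norm_nonneg _) (Real.sqrt_nonneg _)) two_ne_zero).1 hsq
  have h3 : ‖M 2 2‖ ≤ ‖(M *ᵥ lift3 z) 2‖ + ‖M 2 0 * z 0 + M 2 1 * z 1‖ := by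
    rw [mulVec_lift3_two]
    calc ‖M 2 2‖ = ‖(M 2 0 * z 0 + M 2 1 * z 1 + M 2 2) - (M 2 0 * z 0 + M 2 1 * z 1)‖ := by
          congr 1; ring
      _ ≤ ‖M 2 0 * z 0 + M 2 1 * z 1 + M 2 2‖ + ‖M 2 0 * z 0 + M 2 1 * z 1‖ := norm_sub_le _ _
  nlinarith [h3, hbound]

/-- `‖(M (z,1))₂‖² · (1 − nsq (M·z)) = 1 − nsq z` for `M ∈ U(2,1)` and `z` in the ball. -/
theorem sq_norm_denominator_mul (hM : Mᴴ * J * M = J) {z : Fin 2 → ℂ} (hz : z ∈ ball) :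
    ‖(M *ᵥ lift3 z) 2‖ ^ 2 * (1 - nsq (actM M z)) = 1 - nsq z := by
  have h2 := mulVec_lift3_two_ne_zero hM hz
  have hl := lift3_actM h2
  have hq : quadJ (M *ᵥ lift3 z) = quadJ (lift3 z) := quadJ_mulVec hM _
  have hMv : M *ᵥ lift3 z = (M *ᵥ lift3 z) 2 • lift3 (actM M z) := by
    rw [hl, smul_smul, mul_inv_cancel₀ h2, one_smul]
  rw [hMv, quadJ_smul, quadJ_lift3, quadJ_lift3] at hq
  linarith [hq]

/-- **The bound**: for `M ∈ U(2,1)`, `z` in the ball, `nsq z ≤ t²` and `nsq (M·z) ≤ t²` with `0 ≤ t < 1`, every entry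
of `M` is bounded by `K t = 1 / ((1 − t) √(1 − t²))`. -/
theorem norm_entry_le_of_mem_ball (hM : Mᴴ * J * M = J) {z : Fin 2 → ℂ} (hz : z ∈ ball) {t : ℝ} (ht0 : 0 ≤ t)
    (ht1 : t < 1) (hzt : nsq z ≤ t ^ 2) (hwt : nsq (actM M z) ≤ t ^ 2) (i j : Fin 3) :
    ‖M i j‖ ≤ 1 / ((1 - t) * Real.sqrt (1 - t ^ 2)) := by
  have hden := sq_norm_denominator_mul hM hz
  have hkey := norm_two_two_mul_le hM z
  have hsqrt : Real.sqrt (nsq z) ≤ t := Real.sqrt_le_iff.2 ⟨ht0, hzt⟩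
  have ht2 : 0 < 1 - t ^ 2 := by nlinarith
  have h1t : 0 < 1 - t := by linarith
  -- `‖c‖² ≤ 1 / (1 − t²)`
  have hc : ‖(M *ᵥ lift3 z) 2‖ ^ 2 ≤ 1 / (1 - t ^ 2) := by
    have hw : 1 - t ^ 2 ≤ 1 - nsq (actM M z) := by linarith
    have hz1 : 1 - nsq z ≤ 1 := by
      have := nsq_nonneg z
      linarith
    rw [le_div_iff₀ ht2]
    calc ‖(M *ᵥ lift3 z) 2‖ ^ 2 * (1 - t ^ 2) ≤ ‖(M *ᵥ lift3 z) 2‖ ^ 2 * (1 - nsq (actM M z)) := by gcongr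
      _ = 1 - nsq z := hden
      _ ≤ 1 := hz1
  have hc' : ‖(M *ᵥ lift3 z) 2‖ ≤ 1 / Real.sqrt (1 - t ^ 2) := by
    rw [show (1 : ℝ) / Real.sqrt (1 - t ^ 2) = Real.sqrt (1 / (1 - t ^ 2)) by
      rw [Real.sqrt_div' _ ht2.le, Real.sqrt_one]]
    exact Real.le_sqrt_of_sq_le hc
  have h22 : ‖M 2 2‖ ≤ 1 / ((1 - t) * Real.sqrt (1 - t ^ 2)) := by
    have hsq' : 0 < Real.sqrt (1 - t ^ 2) := Real.sqrt_pos.2 ht2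
    have h1 : ‖M 2 2‖ * (1 - t) ≤ ‖(M *ᵥ lift3 z) 2‖ := by
      calc ‖M 2 2‖ * (1 - t) ≤ ‖M 2 2‖ * (1 - Real.sqrt (nsq z)) := by gcongr
        _ ≤ _ := hkey
    rw [le_div_iff₀ (by positivity)]
    calc ‖M 2 2‖ * ((1 - t) * Real.sqrt (1 - t ^ 2)) = (‖M 2 2‖ * (1 - t)) * Real.sqrt (1 - t ^ 2) := by ring
      _ ≤ ‖(M *ᵥ lift3 z) 2‖ * Real.sqrt (1 - t ^ 2) := by gcongr
      _ ≤ (1 / Real.sqrt (1 - t ^ 2)) * Real.sqrt (1 - t ^ 2) := by gcongr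
      _ = 1 := by field_simp
  exact (norm_entry_le_of_U21 hM i j).trans h22

end U21

end Summit.Ventures.HodgeRepro.Tier4

end

#print axioms Summit.Ventures.HodgeRepro.Tier4.norm_entry_le_of_mem_ball
#print axioms Summit.Ventures.HodgeRepro.Tier4.exists_bound_of_isDefinite
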